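import Literature.Combinatorics.SimpleGraph.TreeDecomposition
import Literature.Combinatorics.SimpleGraph.ListTreeDecomposition
import Mathlib.Combinatorics.SimpleGraph.Metric
import Mathlib.Data.Prod.Lex
import Mathlib.Data.Finset.Sort
import Mathlib.Logic.Equiv.Fin.Basic
import HarnessLib

/-!
# Rooting a tree decomposition: from the abstract form to the list form

Topic `Literature/Combinatorics/SimpleGraph`, the bridge between `TreeDecomposition.lean` (a tree
decomposition of `G` indexed by a Mathlib tree on `Fin m`; `treewidth`) and
`ListTreeDecomposition.lean` (the rooted list form `ListTD.IsRootedTD` handed to machines: a parent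
list with parents earlier than children, bags as lists of naturals, (T3) in the rooted form). Every
tree decomposition is brought to the rooted list form, with the same bags: number the tree nodes
by breadth-first order from the node `0` (distance to the root first, node index next), let the
parent of a non-root node be the penultimate vertex of a shortest path from the root, and write
the bags along a numbering `e : V ≃ Fin n` of the vertices. The one non-trivial point is (T3) in
the rooted form — *a vertex of the bag of `t` lying in the bag of an earlier node `s` lies in the
bag of the parent `p` of `t`* —, proved from the subtree condition and the fact that every edge of
a tree is a bridge: the bags containing the vertex connect `t` to `s` avoiding `p`, the shortest
paths from the root to `p` and to `s` avoid the edge `pt` (they are too short to pass through `t`),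
so `p` and `t` would be connected in the tree minus the edge `pt`.

* `root`, `depth`, `key`, `rank` (the breadth-first number), `node` (its inverse), `spath`,
  `parentNode`, `adj_parentNode`, `depth_parentNode`, `rank_parentNode_lt`;
* `mem_bag_parentNode` ((T3), rooted form, on the abstract decomposition);
* `parList`, `bagList` and **`isRootedTD_lists`**; **`exists_isRootedTD`**,
  **`exists_isRootedTD_of_treewidth_le`**: a graph of treewidth `≤ k` on a vertex type numbered by
  `Fin n` has a rooted tree decomposition in list form of the vertices `< n` with bags of size
  `≤ k + 1` covering its edges.

## References

* M. Cygan et al., *Parameterized Algorithms*, Springer 2015, §7.2 (rooted tree decompositions: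
  "we may assume the tree is rooted").
* I. L. Markov, Y. Shi, SIAM J. Comput. 38 (2008), §4, proof of Thm. 4.6, Step 2 (the
  decomposition handed to the contraction).
-/

namespace Literature.Combinatorics.SimpleGraph

namespace TreeDecomposition

open _root_.SimpleGraph Finset ListTD

variable {V : Type*} {G : _root_.SimpleGraph V} {m : ℕ} (D : TreeDecomposition G (Fin m))

/-! ### Breadth-first numbering -/

/-- A tree decomposition has a node. [folklore] -/
theorem pos (D : TreeDecomposition G (Fin m)) : 0 < m := by
  have := D.isTree.1.nonempty
  exact Fin.pos_iff_nonempty.2 this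

/-- **The root**: the node `0`. [folklore] -/
def root : Fin m := ⟨0, D.pos⟩

/-- **The depth** of a node: its distance to the root in the tree. [folklore] -/
noncomputable def depth (t : Fin m) : ℕ := D.tree.dist D.root t

/-- Only the root has depth `0`. [folklore] -/
theorem depth_eq_zero_iff {t : Fin m} : D.depth t = 0 ↔ t = D.root := by
  unfold depth
  rw [(D.isTree.1.preconnected D.root t).dist_eq_zero_iff, eq_comm]

/-- **The breadth-first key** of a node: (depth, index), lexicographically. [folklore] -/
noncomputable def key (t : Fin m) : ℕ ×ₗ ℕ := toLex (D.depth t, (t : ℕ))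

/-- Comparing keys: depth first, index next. [folklore] -/
theorem key_lt_iff {s t : Fin m} : D.key s < D.key t ↔ D.depth s < D.depth t ∨ D.depth s = D.depth t ∧ (s : ℕ) < (t : ℕ) := by
  unfold key
  rw [Prod.Lex.lt_iff]
  simp

/-- Keys are distinct. [folklore] -/
theorem key_injective : Function.Injective D.key := fun s t h => by
  have := congrArg (fun x => (ofLex x).2) h
  exact Fin.ext this

/-- **The breadth-first number** of a node: the number of nodes with a smaller key. [folklore] -/
noncomputable def rank (t : Fin m) : ℕ := (Finset.univ.filter fun s => D.key s < D.key t).card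

/-- The numbering is strictly monotone in the key. [folklore] -/
theorem rank_lt_rank {s t : Fin m} (h : D.key s < D.key t) : D.rank s < D.rank t := by
  unfold rank
  refine Finset.card_lt_card ⟨fun x hx => ?_, fun hsub => ?_⟩
  · simp only [Finset.mem_filter, Finset.mem_univ, true_and] at hx ⊢
    exact hx.trans h
  · have : s ∈ Finset.univ.filter fun x => D.key x < D.key s := hsub (by simpa using h)
    simp at this

/-- The numbering is injective. [folklore] -/
theorem rank_injective : Function.Injective D.rank := fun s t h => by
  rcases lt_trichotomy (D.key s) (D.key t) with hlt | heq | hgt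
  · exact absurd h (D.rank_lt_rank hlt).ne
  · exact D.key_injective heq
  · exact absurd h (D.rank_lt_rank hgt).ne'

/-- Numbers are `< m`. [folklore] -/
theorem rank_lt (t : Fin m) : D.rank t < m := by
  unfold rank
  calc (Finset.univ.filter fun s => D.key s < D.key t).card
      < (Finset.univ : Finset (Fin m)).card :=
        Finset.card_lt_card ⟨Finset.filter_subset _ _, fun h => by simpa using h (Finset.mem_univ t)⟩
    _ = m := Finset.card_fin m

/-- The root is numbered `0`. [folklore] -/
theorem rank_root : D.rank D.root = 0 := by
  unfold rank
  rw [Finset.card_eq_zero, Finset.filter_eq_empty_iff]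
  intro s _ hs
  rw [key_lt_iff] at hs
  have h0 : D.depth D.root = 0 := D.depth_eq_zero_iff.2 rfl
  rcases hs with hs | ⟨-, hs⟩
  · rw [h0] at hs; exact Nat.not_lt_zero _ hs
  · simp [root] at hs

/-- The numbering as a map `Fin m → Fin m`. [folklore] -/
noncomputable def rankFin (t : Fin m) : Fin m := ⟨D.rank t, D.rank_lt t⟩

/-- The numbering is a bijection. [folklore] -/
theorem rankFin_bijective : Function.Bijective D.rankFin :=
  Finite.injective_iff_bijective.1 fun s t h => D.rank_injective (by simpa [rankFin] using congrArg Fin.val h)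

/-- **The node with a given number.** [folklore] -/
noncomputable def node : Fin m ≃ Fin m := (Equiv.ofBijective D.rankFin D.rankFin_bijective).symm

/-- `node` inverts the numbering. [folklore] -/
@[simp] theorem rank_node (j : Fin m) : D.rank (D.node j) = j := by
  have : D.rankFin (D.node j) = j := Equiv.ofBijective_apply_symm_apply D.rankFin D.rankFin_bijective j
  simpa [rankFin] using congrArg Fin.val this

/-- The numbering inverts `node`. [folklore] -/
@[simp] theorem node_rank (t : Fin m) : D.node ⟨D.rank t, D.rank_lt t⟩ = t :=
  Equiv.ofBijective_symm_apply_apply D.rankFin D.rankFin_bijective t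

/-! ### Parents along shortest paths from the root -/

/-- **A shortest path from the root** to `t`. [folklore] -/
noncomputable def spath (t : Fin m) : D.tree.Walk D.root t :=
  Classical.choose (D.isTree.1.preconnected D.root t).exists_walk_length_eq_dist

/-- The chosen path is shortest. [folklore] -/
theorem length_spath (t : Fin m) : (D.spath t).length = D.depth t :=
  Classical.choose_spec (D.isTree.1.preconnected D.root t).exists_walk_length_eq_dist

/-- **The parent of a node**: the penultimate node of its shortest path from the root (the root is
its own parent). [cite: CyganEtAl2015, §7.2 (rooted tree decompositions)] -/
noncomputable def parentNode (t : Fin m) : Fin m := if t = D.root then D.root else (D.spath t).penultimate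

variable {D}

/-- The shortest path to a non-root node is not trivial. [folklore] -/
theorem spath_not_nil {t : Fin m} (ht : t ≠ D.root) : ¬ (D.spath t).Nil := by
  intro hnil
  have h0 : (D.spath t).length = 0 := SimpleGraph.Walk.length_eq_zero_iff.2 hnil
  rw [length_spath] at h0
  exact ht (D.depth_eq_zero_iff.1 h0)

/-- **The parent is adjacent.** [folklore] -/
theorem adj_parentNode {t : Fin m} (ht : t ≠ D.root) : D.tree.Adj (D.parentNode t) t := by
  unfold parentNode; rw [if_neg ht]
  exact SimpleGraph.Walk.adj_penultimate (spath_not_nil ht)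

/-- **The parent is one level up.** [folklore] -/
theorem depth_parentNode {t : Fin m} (ht : t ≠ D.root) : D.depth (D.parentNode t) + 1 = D.depth t := by
  have hconn := D.isTree.1
  unfold parentNode; rw [if_neg ht]
  -- the path minus its last edge reaches the penultimate node
  have h1 : D.depth (D.spath t).penultimate ≤ D.depth t - 1 := by
    have := SimpleGraph.dist_le (D.spath t).dropLast
    rw [SimpleGraph.Walk.length_dropLast, length_spath] at this
    exact this
  -- and the last edge gives the reverse inequality
  have h2 : D.depth t ≤ D.depth (D.spath t).penultimate + 1 := by
    have hadj : D.tree.Adj (D.spath t).penultimate t := SimpleGraph.Walk.adj_penultimate (spath_not_nil ht)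
    have := hconn.dist_triangle (u := D.root) (v := (D.spath t).penultimate) (w := t)
    have hle : D.tree.dist (D.spath t).penultimate t ≤ 1 := by
      have := SimpleGraph.dist_le (SimpleGraph.Walk.cons hadj SimpleGraph.Walk.nil)
      simpa using this
    unfold depth at this ⊢; omega
  have hpos : 0 < D.depth t := Nat.pos_of_ne_zero fun h => ht (D.depth_eq_zero_iff.1 h)
  omega

/-- **The parent is numbered earlier.** [folklore] -/
theorem rank_parentNode_lt {t : Fin m} (ht : t ≠ D.root) : D.rank (D.parentNode t) < D.rank t := by
  refine D.rank_lt_rank ?_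
  rw [key_lt_iff]
  left
  have := depth_parentNode ht; omega

/-! ### (T3) in the rooted form -/

/-- A walk avoiding an edge is a walk in the graph without that edge: reachability. [folklore] -/
theorem reachable_deleteEdges_of_not_mem_edges {W : Type*} {T : _root_.SimpleGraph W} {e : Sym2 W} {u v : W}
    (w : T.Walk u v) (h : e ∉ w.edges) : (T.deleteEdges {e}).Reachable u v :=
  ⟨w.toDeleteEdges {e} fun e' he' he => h (by rw [Set.mem_singleton_iff.1 he] at he'; exact he')⟩

/-- A walk from the root not longer than the depth of `t`, ending elsewhere, does not pass through
`t`: it avoids every edge at `t`. [folklore] -/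
theorem not_mem_edges_of_short [DecidableEq (Fin m)] {s t p : Fin m} (w : D.tree.Walk D.root s)
    (hlen : w.length ≤ D.depth t) (hst : t ≠ s) : s(p, t) ∉ w.edges := by
  intro he
  have hts : t ∈ w.support := SimpleGraph.Walk.snd_mem_support_of_mem_edges w he
  have hlt := SimpleGraph.Walk.length_takeUntil_lt_length hts hst
  have hge := SimpleGraph.dist_le (w.takeUntil t hts)
  unfold depth at hlen
  omega

/-- **(T3), rooted form, for the breadth-first rooting**: a vertex of the bag of `t` lying in the
bag of a node `s ≠ t` that is not deeper than `t` lies in the bag of the parent of `t`.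
[cite: CyganEtAl2015, §7.2 (Lemma 7.3 and rooted decompositions)] -/
theorem mem_bag_parentNode {v : V} {s t : Fin m} (hvt : v ∈ D.bag t) (hvs : v ∈ D.bag s) (hst : s ≠ t)
    (hdepth : D.depth s ≤ D.depth t) (ht : t ≠ D.root) : v ∈ D.bag (D.parentNode t) := by
  classical
  by_contra hp
  set p := D.parentNode t with hpdef
  -- the bags containing `v` connect `t` to `s` avoiding `p`
  have hconn := D.connected_induce v
  obtain ⟨q⟩ := hconn.preconnected ⟨t, hvt⟩ ⟨s, hvs⟩
  have hq'U : ∀ x ∈ (q.map (SimpleGraph.Embedding.induce {x | v ∈ D.bag x}).toHom).support, v ∈ D.bag x := by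
    intro x hx
    rw [SimpleGraph.Walk.support_map, List.mem_map] at hx
    obtain ⟨y, -, rfl⟩ := hx
    exact y.2
  have hts : (D.tree.deleteEdges {s(p, t)}).Reachable t s := by
    refine reachable_deleteEdges_of_not_mem_edges (q.map (SimpleGraph.Embedding.induce {x | v ∈ D.bag x}).toHom)
      fun he => hp ?_
    exact hq'U p (SimpleGraph.Walk.fst_mem_support_of_mem_edges _ he)
  -- the shortest path from the root to `p` avoids the edge `pt`
  have hpen : (D.spath t).penultimate = p := by rw [hpdef, parentNode, if_neg ht]
  have hrp : (D.tree.deleteEdges {s(p, t)}).Reachable D.root p := by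
    have hw : (D.spath t).dropLast.length ≤ D.depth t := by
      rw [SimpleGraph.Walk.length_dropLast, length_spath]; exact Nat.sub_le _ _
    have hne' : t ≠ (D.spath t).penultimate := fun h => (adj_parentNode ht).ne (by rw [← hpdef, ← hpen]; exact h.symm)
    have key := not_mem_edges_of_short (p := p) (D.spath t).dropLast hw hne'
    have := reachable_deleteEdges_of_not_mem_edges _ key
    rwa [hpen] at this
  -- the shortest path from the root to `s` avoids the edge `pt`
  have hrs : (D.tree.deleteEdges {s(p, t)}).Reachable D.root s := by
    have hw : (D.spath s).length ≤ D.depth t := by rw [length_spath]; exact hdepth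
    exact reachable_deleteEdges_of_not_mem_edges _ (not_mem_edges_of_short (p := p) (D.spath s) hw hst.symm)
  -- so `p` and `t` are connected without the edge `pt`, which is a bridge of the tree
  have hreach : (D.tree.deleteEdges {s(p, t)}).Reachable p t := hrp.symm.trans (hrs.trans hts.symm)
  have hbridge : D.tree.IsBridge s(p, t) :=
    SimpleGraph.isAcyclic_iff_forall_isBridge.1 D.isTree.isAcyclic (adj_parentNode ht)
  exact (SimpleGraph.isBridge_iff.1 hbridge) hreach

/-! ### The lists -/

variable (D) {n : ℕ} (e : V ≃ Fin n)

/-- **The parent list**: the number of the parent of the node with each number. [folklore] -/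
noncomputable def parList : List ℕ := List.ofFn fun j : Fin m => D.rank (D.parentNode (D.node j))

/-- **The bag list**: the bag of the node with each number, as the increasing list of the numbers
of its vertices. [folklore] -/
noncomputable def bagList : List (List ℕ) :=
  List.ofFn fun j : Fin m => ((D.bag (D.node j)).image fun v => ((e v : Fin n) : ℕ)).sort (· ≤ ·)

/-- Reading the parent list. [folklore] -/
theorem parOf_parList (j : Fin m) : parOf D.parList j = D.rank (D.parentNode (D.node j)) := by
  simp [parOf, parList, List.getD_eq_getElem?_getD]

/-- Reading the bag list. [folklore] -/
theorem bagOf_bagList (j : Fin m) :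
    bagOf (D.bagList e) j = ((D.bag (D.node j)).image fun v => ((e v : Fin n) : ℕ)).sort (· ≤ ·) := by
  rw [bagOf_eq_getElem (by simp [bagList])]
  simp [bagList]

/-- Membership in a listed bag. [folklore] -/
theorem mem_bagOf_bagList {j : Fin m} {x : ℕ} :
    x ∈ bagOf (D.bagList e) j ↔ ∃ v ∈ D.bag (D.node j), ((e v : Fin n) : ℕ) = x := by
  rw [bagOf_bagList, Finset.mem_sort, Finset.mem_image]

/-- The vertex of a bag in its listed bag. [folklore] -/
theorem mem_bagOf_bagList_rank {t : Fin m} {v : V} (hv : v ∈ D.bag t) :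
    ((e v : Fin n) : ℕ) ∈ bagOf (D.bagList e) (D.rank t) := by
  have := (D.mem_bagOf_bagList e (j := ⟨D.rank t, D.rank_lt t⟩)).2 ⟨v, by rw [node_rank]; exact hv, rfl⟩
  simpa using this

/-- **The lists form a rooted tree decomposition (list form) of the vertices `< n`.**
[cite: CyganEtAl2015, §7.2 (rooted tree decompositions)] -/
theorem isRootedTD_lists : IsRootedTD n D.parList (D.bagList e) := by
  classical
  have hlenB : (D.bagList e).length = m := by simp [bagList]
  have hlenP : D.parList.length = m := by simp [parList]
  refine ⟨by rw [hlenB, hlenP], by rw [hlenB]; exact D.pos, fun j h0 hj => ?_, fun j x hx => ?_, fun j => ?_,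
    fun x hx => ?_, fun x i j hij hj hxj hxi => ?_⟩
  · -- parents are earlier
    rw [hlenB] at hj
    have hne : D.node ⟨j, hj⟩ ≠ D.root := fun h => by
      have := D.rank_node ⟨j, hj⟩; rw [h, rank_root] at this; simp at this; omega
    have := rank_parentNode_lt hne
    rw [D.parOf_parList ⟨j, hj⟩]
    rw [rank_node] at this
    exact this
  · -- bags consist of vertices `< n`
    by_cases hj : j < m
    · obtain ⟨v, -, rfl⟩ := (D.mem_bagOf_bagList e (j := ⟨j, hj⟩)).1 hx
      exact Finset.mem_range.2 (e v).isLt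
    · rw [bagOf_eq_nil (by rw [hlenB]; omega)] at hx; simp at hx
  · -- no repetition
    by_cases hj : j < m
    · rw [D.bagOf_bagList e ⟨j, hj⟩]; exact Finset.sort_nodup _ _
    · rw [bagOf_eq_nil (by rw [hlenB]; omega)]; exact List.nodup_nil
  · -- cover
    obtain ⟨t, ht⟩ := D.exists_mem_bag (e.symm ⟨x, Finset.mem_range.1 hx⟩)
    refine ⟨D.rank t, by rw [hlenB]; exact D.rank_lt t, ?_⟩
    have := D.mem_bagOf_bagList_rank e ht
    simpa using this
  · -- (T3), rooted
    rw [hlenB] at hj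
    have hi : i < m := hij.trans hj
    obtain ⟨v, hvj, rfl⟩ := (D.mem_bagOf_bagList e (j := ⟨j, hj⟩)).1 hxj
    obtain ⟨v', hvi, hvv'⟩ := (D.mem_bagOf_bagList e (j := ⟨i, hi⟩)).1 hxi
    have hv : v' = v := e.injective (Fin.ext hvv')
    subst hv
    set t := D.node ⟨j, hj⟩ with htdef
    set s := D.node ⟨i, hi⟩ with hsdef
    have hrt : D.rank t = j := by rw [htdef, rank_node]
    have hrs : D.rank s = i := by rw [hsdef, rank_node]
    have hst : s ≠ t := fun h => by have := congrArg D.rank h; rw [hrt, hrs] at this; omega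
    have hne : t ≠ D.root := fun h => by rw [h, rank_root] at hrt; omega
    have hdepth : D.depth s ≤ D.depth t := by
      have hk : D.key s < D.key t := by
        rcases lt_trichotomy (D.key s) (D.key t) with h | h | h
        · exact h
        · exact absurd (D.key_injective h) hst
        · have := D.rank_lt_rank h; omega
      rw [key_lt_iff] at hk
      rcases hk with hk | ⟨hk, -⟩
      · exact hk.le
      · exact hk.le
    have hmem := mem_bag_parentNode hvj hvi hst hdepth hne
    rw [D.parOf_parList ⟨j, hj⟩]
    exact D.mem_bagOf_bagList_rank e hmem

/-- **Every tree decomposition has a rooted list form with the same bags**: a rooted tree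
decomposition (list form) of the vertices `< n` (numbered by `e`) covering the edges of `G`, all
bags of size `≤ width + 1`. [cite: CyganEtAl2015, §7.2] -/
theorem exists_isRootedTD [Fintype V] :
    ∃ par bags, IsRootedTD n par bags ∧
      (∀ u v, G.Adj u v → ∃ t, t < bags.length ∧ ((e u : Fin n) : ℕ) ∈ bagOf bags t ∧ ((e v : Fin n) : ℕ) ∈ bagOf bags t) ∧
      ∀ t, t < bags.length → (bagOf bags t).length ≤ D.width + 1 := by
  classical
  refine ⟨D.parList, D.bagList e, D.isRootedTD_lists e, fun u v huv => ?_, fun j hj => ?_⟩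
  · obtain ⟨t, hu, hv⟩ := D.exists_mem_bag_of_adj huv
    exact ⟨D.rank t, by simp [bagList, D.rank_lt t], D.mem_bagOf_bagList_rank e hu, D.mem_bagOf_bagList_rank e hv⟩
  · have hj' : j < m := by simpa [bagList] using hj
    rw [D.bagOf_bagList e ⟨j, hj'⟩, Finset.length_sort]
    exact Finset.card_image_le.trans (D.card_bag_le_width_add_one _)

end TreeDecomposition

/-- **A graph of treewidth `≤ k` has a rooted tree decomposition in list form with bags of size
`≤ k + 1`** (numbering the vertices by `e`), covering its edges. [cite: CyganEtAl2015, §7.2 and Thm 7.18 (the hypothesis tw ≤ k)] -/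
theorem exists_isRootedTD_of_treewidth_le {V : Type*} [Fintype V] {G : _root_.SimpleGraph V} {n k : ℕ}
    (e : V ≃ Fin n) (hk : treewidth G ≤ k) :
    ∃ par bags, ListTD.IsRootedTD n par bags ∧
      (∀ u v, G.Adj u v → ∃ t, t < bags.length ∧ ((e u : Fin n) : ℕ) ∈ ListTD.bagOf bags t ∧
        ((e v : Fin n) : ℕ) ∈ ListTD.bagOf bags t) ∧
      ∀ t, t < bags.length → (ListTD.bagOf bags t).length ≤ k + 1 := by
  obtain ⟨m, D, hD⟩ := exists_width_eq_treewidth G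
  obtain ⟨par, bags, h1, h2, h3⟩ := D.exists_isRootedTD e
  exact ⟨par, bags, h1, h2, fun t ht => (h3 t ht).trans (by rw [hD]; omega)⟩

end Literature.Combinatorics.SimpleGraph
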